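import Summits.ResolutionOfSingularities.ResolutionOfSingularities.Theorems.ShallowPort2

/-!
# ShallowPort3 — closed centres, singular stages, and the stalk chain along a forced tower (§7–§8)

* §7 `exists_specializes_ne_le_idealOrder` (generization of symbolic-power membership to a point of the top locus),
  `isMaximal_of_isNormallyFlat_of_isolated` (with Bennett §2: a normally flat regular centre through a point ISOLATED in the top
  locus is the closed point), `not_isRegularLocalRing_range` (order `≥ 2` ⇒ singular image).
* §8 `Stage`, `tower_step`, `nextStage`, `chain` — the stalk chain `φ_i : 𝒪_{X_i,x_i} → L` grown from a stage-`0` map along a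
  forced tower; `chain_dominates`, `chain_isQuadraticTransformAlong` (for any valuation ring dominating the chain),
  `chain_isMaximal_of_isNormallyFlat`, `chain_not_isRegularLocalRing`.

References: CJS LNM 2270 Thm. 3.3 [CossartJannsenSaito2020]; CP 2019 Def. 2.3 [CossartPiltant2019]. AI-written; weaker than expert review.
(decomp-res lens-5 g38, critic ROW 232 (M-Shallow); host route `MaxContactCut`, item stmt-ResolutionOfSingularities-31768 `PolyPureTowersShallow`;
source of truth: the farm-checked monolith `ShallowPortNode.lean`, of which this is land slice 3/6 — slices land sequentially, slice k imports slice k-1.)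
-/

noncomputable section

set_option linter.dupNamespace false

open IsLocalRing IsLocalization
open Literature.RingTheory.HilbertSamuel Literature.AlgebraicGeometry.Resolution
open Summit.ResolutionOfSingularities.ResolutionOfSingularities.Theorems.SigmaMaxModificationsCorridor3.Helpers
open Summit.ResolutionOfSingularities.ResolutionOfSingularities.Theorems.SwitchingDichotomy.SteeredRun

universe u

namespace Summit.ResolutionOfSingularities.ResolutionOfSingularities.Theorems.ShallowPort

/-! ## §7 Generization of symbolic-power memberships; normally flat centres of the stages are the
closed points; the stages are singular -/

section Gener

open CategoryTheory AlgebraicGeometry TopologicalSpace Topology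
open Scheme.IdealSheafData

/-- **Generization of a symbolic-power membership** (Stacks 01J7: the primes of `𝒪_{X,x}` are the
generizations of `x`, and `𝒪_{X,ζ} = (𝒪_{X,x})_P`).  If `I_x = (f)` and the image of `f` lies in the
`n`-th power of the maximal ideal of `(𝒪_{X,x})_P` for a prime `P ≠ 𝔪_x`, then there is a proper
generization `ζ ⤳ x`, `ζ ≠ x`, with `ord_ζ I ≥ n`. [cite: StacksProject, Tag 01J7] -/
theorem exists_specializes_ne_le_idealOrder {X : Scheme.{u}} {x : X} (I : X.IdealSheafData)
    {f : X.presheaf.stalk x} (hf : stalkIdeal I x = Ideal.span {f})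
    (P : Ideal (X.presheaf.stalk x)) [P.IsPrime] (hP : P ≠ maximalIdeal (X.presheaf.stalk x))
    {n : ℕ} (hn : algebraMap (X.presheaf.stalk x) (Localization.AtPrime P) f ∈
      maximalIdeal (Localization.AtPrime P) ^ n) :
    ∃ ζ : X, ζ ⤳ x ∧ ζ ≠ x ∧ ((n : ℕ) : ℕ∞) ≤ idealOrder I ζ := by
  obtain ⟨ζ, h, hPeq⟩ := exists_specializes_comap_stalkSpecializes_eq x P
  refine ⟨ζ, h, ?_, ?_⟩
  · rintro rfl
    apply hP
    have h1 : X.presheaf.stalkSpecializes h = 𝟙 _ := TopCat.Presheaf.stalkSpecializes_refl _ _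
    rw [hPeq, h1, CommRingCat.hom_id, Ideal.comap_id]
  · subst hPeq
    letI alg := (X.presheaf.stalkSpecializes h).hom.toAlgebra
    haveI hloc := isLocalizationAtPrime_stalkSpecializes h
    let e : Localization.AtPrime ((maximalIdeal (X.presheaf.stalk ζ)).comap
        (X.presheaf.stalkSpecializes h).hom) ≃ₐ[X.presheaf.stalk x] X.presheaf.stalk ζ :=
      IsLocalization.algEquiv ((maximalIdeal (X.presheaf.stalk ζ)).comap
        (X.presheaf.stalkSpecializes h).hom).primeCompl _ _
    have he : e.toRingEquiv (algebraMap _ _ f) = (X.presheaf.stalkSpecializes h).hom f := e.commutes f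
    rw [le_idealOrder_iff, stalkIdeal_eq_span_stalkSpecializes h I hf, Ideal.span_singleton_le_iff_mem,
      ← he]
    have h2 := Ideal.mem_map_of_mem e.toRingEquiv hn
    rwa [Ideal.map_pow, map_ringEquiv_maximalIdeal] at h2

set_option maxHeartbeats 800000 in
/-- **Normally flat regular centres through an isolated point of the top locus are the closed point.**
Let `X` be a regular locally Noetherian scheme, `x ∈ X`, `I ⊆ 𝒪_X` with `I_x = (f)`, `f ≠ 0`,
`f ∈ 𝔪_x ^ n`, and suppose `x` is the only point `ζ ⤳ x` with `ord_ζ I ≥ n`.  Let `φ : 𝒪_{X,x} → L`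
be a ring map to a field with kernel `I_x`, so that `B = φ(𝒪_{X,x}) ≅ 𝒪_{X,x}/(f)`.  Then every prime
`P ⊆ B` with `B/P` regular and `B` normally flat along `P` is the maximal ideal: by Bennett's
theorem (Hilbert function of `gr_P` = Hilbert–Samuel function at the generic point of `V(P)`,
`algebraMap_mem_pow_of_isNormallyFlat`) the multiplicity of `B` at `P` is `≥ n`, i.e.
`f ∈ 𝔓^{(n)}` for the prime `𝔓 ⊆ 𝒪_{X,x}` over `P`, and the generization `ζ` of `x` with
`𝒪_{X,ζ} = (𝒪_{X,x})_𝔓` has `ord_ζ I ≥ n`, forcing `ζ = x`, `𝔓 = 𝔪_x`, `P = 𝔪_B`.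
[cite: CossartJannsenSaito2020, Thm 3.3 and Thm 3.10(3); StacksProject, Tag 01J7] -/
theorem isMaximal_of_isNormallyFlat_of_isolated {X : Scheme.{0}} [IsLocallyNoetherian X]
    (hX : Scheme.IsRegular X) {x : X} (I : X.IdealSheafData) {f : X.presheaf.stalk x}
    (hf : stalkIdeal I x = Ideal.span {f}) {n : ℕ} (hfn : f ∈ maximalIdeal (X.presheaf.stalk x) ^ n)
    (hf0 : f ≠ 0) (hiso : ∀ ζ : X, ζ ⤳ x → ((n : ℕ) : ℕ∞) ≤ idealOrder I ζ → ζ = x)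
    {L : Type} [Field L] (φ : X.presheaf.stalk x →+* L) (hker : RingHom.ker φ = stalkIdeal I x)
    (P : Ideal φ.range) [hreg : IsRegularLocalRing (φ.range ⧸ P)] (hNF : P.IsNormallyFlat) :
    P.IsMaximal := by
  haveI : IsRegularLocalRing (X.presheaf.stalk x) := hX x
  have hker' : RingHom.ker φ = Ideal.span {f} := hker.trans hf
  obtain ⟨e⟩ : Nonempty ((X.presheaf.stalk x ⧸ Ideal.span {f}) ≃+* φ.range) :=
    ⟨(Ideal.quotEquivOfEq hker'.symm).trans (RingHom.quotientKerEquivRange φ)⟩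
  haveI hPp : P.IsPrime :=
    (Ideal.Quotient.isDomain_iff_prime (I := P)).mp (isDomain_of_isRegularLocalRing _)
  let P' : Ideal (X.presheaf.stalk x ⧸ Ideal.span {f}) := P.comap e
  haveI hP'p : P'.IsPrime := Ideal.comap_isPrime e P
  have hPe : P = P'.map (e : (X.presheaf.stalk x ⧸ Ideal.span {f}) →+* φ.range) := by
    rw [Ideal.map_coe]
    exact (Ideal.map_comap_of_surjective e e.surjective P).symm
  haveI : IsRegularLocalRing ((X.presheaf.stalk x ⧸ Ideal.span {f}) ⧸ P') :=
    IsRegularLocalRing.of_ringEquiv (R := φ.range ⧸ P) (Ideal.quotientEquiv P' P e hPe).symm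
  have hNF' : P'.IsNormallyFlat := by
    have h := Ideal.IsNormallyFlat.map_ringEquiv e.symm hNF
    rwa [Ideal.map_coe, Ideal.map_symm] at h
  have hmem := algebraMap_mem_pow_of_isNormallyFlat hf0 hfn P' hNF'
  have hsurj := Ideal.Quotient.mk_surjective (I := Ideal.span {f})
  -- the prime `𝔓 = mk⁻¹ P'` of `𝒪_{X,x}` is the maximal ideal, by isolation
  have h𝔓 : P'.comap (Ideal.Quotient.mk (Ideal.span {f})) = maximalIdeal (X.presheaf.stalk x) := by
    by_contra hne
    obtain ⟨ζ, hζ, hζx, hord⟩ := exists_specializes_ne_le_idealOrder I hf _ hne hmem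
    exact hζx (hiso ζ hζ hord)
  haveI hP'max : P'.IsMaximal := by
    have hM : (P'.comap (Ideal.Quotient.mk (Ideal.span {f}))).IsMaximal := by
      rw [h𝔓]; exact IsLocalRing.maximalIdeal.isMaximal _
    rcases Ideal.map_eq_top_or_isMaximal_of_surjective _ hsurj hM with htop | hmax
    · rw [Ideal.map_comap_of_surjective _ hsurj] at htop
      exact absurd htop hP'p.ne_top
    · rwa [Ideal.map_comap_of_surjective _ hsurj] at hmax
  rw [hPe, Ideal.map_coe, ← Ideal.comap_symm]
  exact Ideal.comap_isMaximal_of_surjective e.symm e.symm.surjective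

/-- **The stages are singular**: if `A` is a regular local ring, `0 ≠ f ∈ 𝔪_A ^ 2` and
`φ : A → L` has kernel `(f)`, then `φ(A) ≅ A/(f)` is not regular (a regular quotient `A/(f)` of a
regular local ring forces `f ∉ 𝔪_A²`, Matsumura 14.2). [cite: Matsumura1987, Thm. 14.2] -/
theorem not_isRegularLocalRing_range {A : Type u} [CommRing A] [IsRegularLocalRing A] {f : A}
    (hf2 : f ∈ maximalIdeal A ^ 2) (hf0 : f ≠ 0) {L : Type} [Field L] (φ : A →+* L)
    (hker : RingHom.ker φ = Ideal.span {f}) : ¬ IsRegularLocalRing φ.range := by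
  intro hreg
  let e : (A ⧸ Ideal.span {f}) ≃+* φ.range :=
    (Ideal.quotEquivOfEq hker.symm).trans (RingHom.quotientKerEquivRange φ)
  haveI : IsRegularLocalRing (A ⧸ Ideal.span {f}) := IsRegularLocalRing.of_ringEquiv e.symm
  have hf𝔪 : f ∈ maximalIdeal A := Ideal.pow_le_self two_ne_zero hf2
  exact notMem_sq_of_isRegularLocalRing_quotient hf𝔪 hf0 hf2

end Gener


/-! ## §8 The stalk chain along a forced tower -/

section Chain

open CategoryTheory AlgebraicGeometry TopologicalSpace Topology
open Scheme.IdealSheafData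
open Summit.ResolutionOfSingularities.ResolutionOfSingularities.Theorems.ForcedTowerClasses
open Summit.ResolutionOfSingularities.ResolutionOfSingularities.Theorems.HugValuationCut

variable {k : Type} [Field k]

/-- DEFINITION (support). **A stage of the stalk chain**: a ring map `φ_i : 𝒪_{X_i,x_i} → L` whose kernel is exactly
the (principal) marked stalk ideal `(I_i)_{x_i}`. -/
structure Stage (T : ForcedTower) (L : Type) [Field L] (i : ℕ) : Type where
  /-- the stalk map -/
  φ : (T.St i).presheaf.stalk (T.pt i) →+* L
  /-- its kernel is the marked stalk ideal -/
  ker_eq : RingHom.ker φ = stalkIdeal (T.D i).ideal (T.pt i)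
  /-- the marked stalk ideal is principal -/
  principal : (stalkIdeal (T.D i).ideal (T.pt i)).IsPrincipal

/-- **The step along the tower**: a stage-`i` map extends to a stage-`(i+1)` map whose image dominates and is the
certified point blow-up of the image of stage `i` (`exists_extension_ker_eq_controlledTransform` at `x_{i+1} ↦ x_i`,
`tower_isBlowup_vanishingIdeal`, `tower_ideal_succ_eq_controlledTransform`, `tower_idealOrder_pt_eq`).
[cite: HerrmannIkedaOrbanz1988, Thm. (30.2) (proof)] [cite: CossartPiltant2019, §2.2] -/
theorem tower_step (T : ForcedTower) (g : T.St 0 ⟶ Spec (.of k)) (hB : IsBase (T.St 0) g) {q : ℕ} (hq : 1 ≤ q)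
    (hD : IsDatum q (T.D 0)) (i : ℕ) {L : Type} [Field L] (S : Stage T L i) :
    ∃ φ' : (T.St (i + 1)).presheaf.stalk (T.pt (i + 1)) →+* L,
      RingHom.ker φ' = stalkIdeal (T.D (i + 1)).ideal (T.pt (i + 1)) ∧
      (stalkIdeal (T.D (i + 1)).ideal (T.pt (i + 1))).IsPrincipal ∧
      SubringDominates S.φ.range φ'.range ∧
      Nonempty (PointBlowupCert S.φ.range φ'.range ((maximalIdeal _).map S.φ.rangeRestrict)) := by
  haveI : IsLocallyNoetherian (T.St i) := (tower_isLocallyNoetherian_isRegular T g hB i).1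
  haveI : IsLocallyNoetherian (T.St (i + 1)) := (tower_isLocallyNoetherian_isRegular T g hB (i + 1)).1
  have hX : Scheme.IsRegular (T.St i) := (tower_isLocallyNoetherian_isRegular T g hB i).2
  have hX' : Scheme.IsRegular (T.St (i + 1)) := (tower_isLocallyNoetherian_isRegular T g hB (i + 1)).2
  -- the step at a general point `x = π_i(x_{i+1})` of `X_i`
  have key : ∀ (x : T.St i) (hx : (T.π i).base (T.pt (i + 1)) = x) (hc : IsClosed ({x} : Set (T.St i))),
      Scheme.IsRegular (vanishingIdeal (⟨{x}, hc⟩ : Closeds (T.St i))).subscheme →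
      IsBlowup (T.π i) (vanishingIdeal (⟨{x}, hc⟩ : Closeds (T.St i))) →
      (T.D (i + 1)).ideal = controlledTransform (T.π i) (vanishingIdeal (⟨{x}, hc⟩ : Closeds (T.St i))) (T.D i).ideal q →
      idealOrder (T.D i).ideal x = ((q : ℕ) : ℕ∞) →
      ∀ (φ : (T.St i).presheaf.stalk x →+* L), RingHom.ker φ = stalkIdeal (T.D i).ideal x →
      (stalkIdeal (T.D i).ideal x).IsPrincipal →
      ∃ φ' : (T.St (i + 1)).presheaf.stalk (T.pt (i + 1)) →+* L,
        RingHom.ker φ' = stalkIdeal (T.D (i + 1)).ideal (T.pt (i + 1)) ∧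
        (stalkIdeal (T.D (i + 1)).ideal (T.pt (i + 1))).IsPrincipal ∧
        SubringDominates φ.range φ'.range ∧
        Nonempty (PointBlowupCert φ.range φ'.range ((maximalIdeal _).map φ.rangeRestrict)) := by
    intro x hx
    subst hx
    intro hc hreg hbl hsucc hordx φ hker hpr
    have hx' : stalkIdeal (controlledTransform (T.π i) (vanishingIdeal (⟨{(T.π i).base (T.pt (i + 1))}, hc⟩ :
        Closeds (T.St i))) (T.D i).ideal q) (T.pt (i + 1)) ≤ maximalIdeal _ := by
      rw [← hsucc]
      exact (tower_stalkIdeal_le_pow T hD (i + 1)).trans (Ideal.pow_le_self (Nat.one_le_iff_ne_zero.mp hq))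
    obtain ⟨φ', h1, h2, h3, h4⟩ := exists_extension_ker_eq_controlledTransform hX hX' hc hreg hbl (T.D i).ideal hq
      hordx hpr hx' φ hker
    refine ⟨φ', ?_, ?_, subringDominates_range ((T.π i).stalkMap (T.pt (i + 1))).hom φ φ' h3, h4⟩
    · rw [hsucc]; exact h1
    · rw [hsucc]; exact h2
  have hreg := T.centre_regular i
  rw [tower_centre_eq_vanishingIdeal T i] at hreg
  exact key (T.pt i) (T.pt_map i) (T.isClosed_pt i) hreg (tower_isBlowup_vanishingIdeal T i)
    (tower_ideal_succ_eq_controlledTransform T hD i) (tower_idealOrder_pt_eq T g hB hD i) S.φ S.ker_eq S.principal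

/-- DEFINITION (support). **The next stage** (a choice of the extension of `tower_step`). -/
noncomputable def nextStage (T : ForcedTower) (g : T.St 0 ⟶ Spec (.of k)) (hB : IsBase (T.St 0) g) {q : ℕ}
    (hq : 1 ≤ q) (hD : IsDatum q (T.D 0)) (i : ℕ) {L : Type} [Field L] (S : Stage T L i) : Stage T L (i + 1) :=
  ⟨Classical.choose (tower_step T g hB hq hD i S), (Classical.choose_spec (tower_step T g hB hq hD i S)).1,
    (Classical.choose_spec (tower_step T g hB hq hD i S)).2.1⟩

/-- The image of the next stage dominates the image of the stage. [folklore] -/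
theorem nextStage_dominates (T : ForcedTower) (g : T.St 0 ⟶ Spec (.of k)) (hB : IsBase (T.St 0) g) {q : ℕ}
    (hq : 1 ≤ q) (hD : IsDatum q (T.D 0)) (i : ℕ) {L : Type} [Field L] (S : Stage T L i) :
    SubringDominates S.φ.range (nextStage T g hB hq hD i S).φ.range :=
  (Classical.choose_spec (tower_step T g hB hq hD i S)).2.2.1

/-- The image of the next stage is the certified point blow-up of the image of the stage. [folklore] -/
theorem nextStage_cert (T : ForcedTower) (g : T.St 0 ⟶ Spec (.of k)) (hB : IsBase (T.St 0) g) {q : ℕ}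
    (hq : 1 ≤ q) (hD : IsDatum q (T.D 0)) (i : ℕ) {L : Type} [Field L] (S : Stage T L i) :
    Nonempty (PointBlowupCert S.φ.range (nextStage T g hB hq hD i S).φ.range ((maximalIdeal _).map S.φ.rangeRestrict)) :=
  (Classical.choose_spec (tower_step T g hB hq hD i S)).2.2.2

/-- DEFINITION (support). **The stalk chain** `φ_0, φ_1, …` grown from a stage-`0` map. -/
noncomputable def chain (T : ForcedTower) (g : T.St 0 ⟶ Spec (.of k)) (hB : IsBase (T.St 0) g) {q : ℕ}
    (hq : 1 ≤ q) (hD : IsDatum q (T.D 0)) {L : Type} [Field L] (S₀ : Stage T L 0) : ∀ i, Stage T L i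
  | 0 => S₀
  | i + 1 => nextStage T g hB hq hD i (chain T g hB hq hD S₀ i)

/-- The images `B_i = φ_i(𝒪_{X_i,x_i})` are local rings. [folklore] -/
theorem isLocalRing_chain_range (T : ForcedTower) (g : T.St 0 ⟶ Spec (.of k)) (hB : IsBase (T.St 0) g) {q : ℕ}
    (hq : 1 ≤ q) (hD : IsDatum q (T.D 0)) {L : Type} [Field L] (S₀ : Stage T L 0) (i : ℕ) :
    IsLocalRing (chain T g hB hq hD S₀ i).φ.range :=
  isLocalRing_range _

/-- `B_{i+1}` dominates `B_i`. [folklore] -/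
theorem chain_dominates (T : ForcedTower) (g : T.St 0 ⟶ Spec (.of k)) (hB : IsBase (T.St 0) g) {q : ℕ}
    (hq : 1 ≤ q) (hD : IsDatum q (T.D 0)) {L : Type} [Field L] (S₀ : Stage T L 0) (i : ℕ) :
    SubringDominates (chain T g hB hq hD S₀ i).φ.range (chain T g hB hq hD S₀ (i + 1)).φ.range :=
  nextStage_dominates T g hB hq hD i _

/-- **The chain is a sequence of quadratic transforms along any valuation ring dominating it.**
[cite: HerrmannIkedaOrbanz1988, Thm. (30.2)] [cite: CossartPiltant2019, §2.2] -/
theorem chain_isQuadraticTransformAlong (T : ForcedTower) (g : T.St 0 ⟶ Spec (.of k)) (hB : IsBase (T.St 0) g)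
    {q : ℕ} (hq : 1 ≤ q) (hD : IsDatum q (T.D 0)) {L : Type} [Field L] (S₀ : Stage T L 0)
    (O : ValuationSubring L) (hO : ∀ i, SubringDominates (chain T g hB hq hD S₀ i).φ.range O.toSubring) (i : ℕ) :
    IsQuadraticTransformAlong O (chain T g hB hq hD S₀ i).φ.range (chain T g hB hq hD S₀ (i + 1)).φ.range := by
  haveI : IsLocalRing (nextStage T g hB hq hD i (chain T g hB hq hD S₀ i)).φ.range := isLocalRing_range _
  obtain ⟨hc⟩ := nextStage_cert T g hB hq hD i (chain T g hB hq hD S₀ i)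
  have h := isLocalBlowupAlong_of_cert hc (hO (i + 1))
  rw [map_rangeRestrict_maximalIdeal] at h
  exact ⟨isLocalRing_range _, h⟩

/-- A generator of the marked stalk ideal of stage `i`: nonzero, in `𝔪^q`. [folklore] -/
theorem exists_generator_stage (T : ForcedTower) (g : T.St 0 ⟶ Spec (.of k)) (hB : IsBase (T.St 0) g) {q : ℕ}
    (hD : IsDatum q (T.D 0)) (i : ℕ) (hpr : (stalkIdeal (T.D i).ideal (T.pt i)).IsPrincipal) :
    ∃ f : (T.St i).presheaf.stalk (T.pt i), stalkIdeal (T.D i).ideal (T.pt i) = Ideal.span {f} ∧ f ≠ 0 ∧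
      f ∈ maximalIdeal _ ^ q := by
  obtain ⟨f, hf⟩ := hpr
  have hf' : stalkIdeal (T.D i).ideal (T.pt i) = Ideal.span {f} := hf
  refine ⟨f, hf', ?_, ?_⟩
  · intro h0
    have hord := tower_idealOrder_pt_eq T g hB hD i
    have hle : (((q + 1 : ℕ) : ℕ) : ℕ∞) ≤ idealOrder (T.D i).ideal (T.pt i) := by
      rw [le_idealOrder_iff, hf', h0, Ideal.span_singleton_eq_bot.mpr rfl]
      exact bot_le
    rw [hord] at hle
    have := ENat.coe_le_coe.mp hle
    omega
  · have h := tower_stalkIdeal_le_pow T hD i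
    rw [hf'] at h
    exact (Ideal.span_singleton_le_iff_mem _).mp h

/-- **(hnpc) the normally flat regular centres of the stages are the closed points.**
[cite: CossartJannsenSaito2020, Thm 3.3] [cite: StacksProject, Tag 01J7] -/
theorem chain_isMaximal_of_isNormallyFlat (T : ForcedTower) (g : T.St 0 ⟶ Spec (.of k)) (hB : IsBase (T.St 0) g)
    {q : ℕ} (hq : 1 ≤ q) (hD : IsDatum q (T.D 0)) {L : Type} [Field L] (S₀ : Stage T L 0) (i : ℕ)
    (C : Subring L) (hC : C = (chain T g hB hq hD S₀ i).φ.range) (P : Ideal C) (hreg : IsRegularLocalRing (C ⧸ P))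
    (hNF : P.IsNormallyFlat) : P.IsMaximal := by
  subst hC
  haveI : IsLocallyNoetherian (T.St i) := (tower_isLocallyNoetherian_isRegular T g hB i).1
  haveI := hreg
  obtain ⟨f, hf, hf0, hfq⟩ := exists_generator_stage T g hB hD i (chain T g hB hq hD S₀ i).principal
  obtain ⟨U, hxU, hU⟩ := tower_exists_isolating_open T hD i
  exact isMaximal_of_isNormallyFlat_of_isolated (tower_isLocallyNoetherian_isRegular T g hB i).2 (T.D i).ideal hf hfq
    hf0 (fun ζ hζ hord => hU ζ (hζ.mem_open U.2 hxU) hord) (chain T g hB hq hD S₀ i).φ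
    (chain T g hB hq hD S₀ i).ker_eq P hNF

/-- **(hsing) the stages are singular** (`q ≥ 2`). [cite: Matsumura1987, Thm. 14.2] -/
theorem chain_not_isRegularLocalRing (T : ForcedTower) (g : T.St 0 ⟶ Spec (.of k)) (hB : IsBase (T.St 0) g)
    {q : ℕ} (hq : 2 ≤ q) (hD : IsDatum q (T.D 0)) {L : Type} [Field L] (S₀ : Stage T L 0) (i : ℕ) :
    ¬ IsRegularLocalRing (chain T g hB (le_trans one_le_two hq) hD S₀ i).φ.range := by
  haveI : IsRegularLocalRing ((T.St i).presheaf.stalk (T.pt i)) := (tower_isLocallyNoetherian_isRegular T g hB i).2 _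
  obtain ⟨f, hf, hf0, hfq⟩ := exists_generator_stage T g hB hD i (chain T g hB (le_trans one_le_two hq) hD S₀ i).principal
  exact not_isRegularLocalRing_range (Ideal.pow_le_pow_right hq hfq) hf0 _
    (((chain T g hB (le_trans one_le_two hq) hD S₀ i).ker_eq).trans hf)

end Chain

end Summit.ResolutionOfSingularities.ResolutionOfSingularities.Theorems.ShallowPort
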